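import Mathlib
import HarnessLib
import Literature.MathematicalPhysics.QuantumLattice.GrassmannEffectiveActionCopies
import Summits.HubbardSuperconductivity.HubbardSuperconductivity.Theorems.KLProgrammeKLRegimeTwoVolumeTorusBlocks
import Summits.HubbardSuperconductivity.HubbardSuperconductivity.Theorems.KLProgrammeKLRegimeTwoVolumeReadoutPin

/-!
# Route `KLProgramme` — ENGINE child `KLRegimeEngineV16` (stmt-HubbardSuperconductivity-20236), `stub_twoLeg_scale0`, conjunct
# (E3f-AT)₀, spatial nested leg `hsp`: the GLUE between the read-out's centred block at a pin and the `⌊x/m⌋` block structure of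
# the copies action (cell gate-hubbard-kl, seat hubbard-kl-k3c5-p2 g6, β′ lane)

The door `…TwoVolumeReadoutPin.abs_klLocalPart_sub_le_gridDefect_pin` charges the two-volume difference of the local part to
`Def_w = Σ_{p₁} ‖W₂(ō⁺,p₁⁻) − W′₂(w⁺,(ι p₁)⁻)‖ + Σ_{p₁′ ∉ range ι} ‖W′₂(w⁺,p₁′⁻)‖` with the CENTRED block embedding
`ι (j, x̄) = (j, site w + clift(x̄ − c̄))`, `c̄ = (r₀,r₀)`, `r₀ = (Lc−1)/2`, `ō = (time w, c̄)`.  The covariance side of β′ (k3c4-p1's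
`…TwoVolumeBlockDefect`, `GrassmannEffectiveActionCopies`) is built on the block structure `e` of `…TwoVolumeTorusBlocks`
(`blk = ⌊x_i/m⌋`, `red = x_i mod m`) and reads the decoupled action `Σ_β W∘f_β`, whose two-leg kernel at `(w⁺, Y′)` is
`[blk Y′ = blk w]·W₂(red w, red Y′)` ([tree] `kernel_copies_sum`).  When the pin `w` has residue `(r₀, r₀)` — the DEEPEST point of its
`⌊x/m⌋`-block — the two pictures coincide:

* §1 one coordinate (`Lf = b·Lc`, residue `A.val % Lc = r₀`): the centred representative range `(−Lc/2, Lc/2]` is exactly `[−r₀, Lc−1−r₀]`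
  (`cRepZ_bounds_r₀`), so `A + clift c` stays in `A`'s block with residue `r₀ + c` (`val_add_intCast_of_residue`), and conversely every
  point of `A`'s block is `A + clift(its residue − r₀)` (`eq_add_clift_of_block_eq`);
* §2 the site/leg statements: `red (site w) = c̄`, `blk (site (ι p)) = blk (site w)`, `red (site (ι p)) = p.2`, and
  `blk x′ = blk (site w) ⇒ x′ ∈ site-range`;
* §3 **`gridDefect_pin_eq_copies_defect`**: for the `e` of `exists_gridLegBlockEquiv` and embeddings `F β` as in `kernel_copies_sum`,
  `Def_w(W, W′) = Σ_{p₁′ : GridPoint Lf N} ‖kernel W′ 2 (w⁺,p₁′⁻) − kernel (Σ_β map (F β) W) 2 (w⁺,p₁′⁻)‖`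
  — the `(σ,+;σ,−)` string of the pinned copies defect at `w`, i.e. a sub-sum of what `sum_norm_kernel_twoVolumeDefect_le` (p515439) bounds.

Proofs only; no definitions; pure torus/leg bookkeeping.
-/

noncomputable section

namespace Summit.HubbardSuperconductivity.HubbardSuperconductivity.Theorems.TwoVolumeDefect

set_option linter.dupNamespace false -- summit = problem name (single-conjunct summit), D-0017

open Finset Literature.MathematicalPhysics.QuantumLattice Literature.Probability.LatticeModels GrassmannAlgebra

/-! ## §1 One coordinate -/

section OneCoordinate

variable {b Lc Lf : ℕ} [NeZero Lc] [NeZero Lf]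

omit [NeZero Lf] in
/-- The centred representative of a coarse residue lies in `[−r₀, Lc − 1 − r₀]`, `r₀ = (Lc−1)/2`. -/
theorem cRepZ_bounds_r₀ (z : ZMod Lc) :
    -(((Lc - 1) / 2 : ℕ) : ℤ) ≤ Torus.cRepZ z ∧ Torus.cRepZ z + (((Lc - 1) / 2 : ℕ) : ℤ) ≤ (Lc : ℤ) - 1 := by
  have h := Torus.two_mul_cRepZ_bounds z
  have hLc : 1 ≤ Lc := Nat.one_le_iff_ne_zero.2 (NeZero.ne Lc)
  constructor <;> omega

omit [NeZero Lc] in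
/-- **A residue-`r₀` point plus a centred offset stays in its block**: for `A : ZMod Lf` (`Lf = b·Lc`) with `A.val % Lc = r₀` and an integer
`c` with `−r₀ ≤ c`, `c + r₀ ≤ Lc − 1`: `(A + c).val = A.val + c` (as integers). -/
theorem val_add_intCast_of_residue (hL : Lf = b * Lc) {A : ZMod Lf} (hA : A.val % Lc = (Lc - 1) / 2) {c : ℤ}
    (hc1 : -(((Lc - 1) / 2 : ℕ) : ℤ) ≤ c) (hc2 : c + (((Lc - 1) / 2 : ℕ) : ℤ) ≤ (Lc : ℤ) - 1) :
    ((A + (c : ZMod Lf)).val : ℤ) = (A.val : ℤ) + c := by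
  have hdm : Lc * (A.val / Lc) + A.val % Lc = A.val := Nat.div_add_mod A.val Lc
  have hq : A.val / Lc < b := val_div_lt (m := Lc) (M := Lf) hL A
  have hP : Lc * (A.val / Lc) + Lc ≤ b * Lc := by
    have := Nat.mul_le_mul_left Lc hq
    rw [Nat.mul_succ] at this
    linarith [mul_comm Lc b]
  have hPz : ((Lc * (A.val / Lc) : ℕ) : ℤ) + Lc ≤ ((b * Lc : ℕ) : ℤ) := by exact_mod_cast hP
  have hdmz : ((Lc * (A.val / Lc) : ℕ) : ℤ) + ((A.val % Lc : ℕ) : ℤ) = A.val := by exact_mod_cast hdm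
  have hAz : ((A.val % Lc : ℕ) : ℤ) = (((Lc - 1) / 2 : ℕ) : ℤ) := by rw [hA]
  have h0 : 0 ≤ (A.val : ℤ) + c := by
    have : (0 : ℤ) ≤ ((Lc * (A.val / Lc) : ℕ) : ℤ) := by positivity
    linarith
  have h1 : (A.val : ℤ) + c < Lf := by
    have hLf : (Lf : ℤ) = ((b * Lc : ℕ) : ℤ) := by rw [hL]
    linarith
  have hcast : A + (c : ZMod Lf) = ((((A.val : ℤ) + c) : ℤ) : ZMod Lf) := by
    push_cast
    rw [ZMod.natCast_zmod_val]
  obtain ⟨n, hn⟩ := Int.eq_ofNat_of_zero_le h0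
  have hnL : n < Lf := by
    have : (n : ℤ) < Lf := hn ▸ h1
    exact_mod_cast this
  rw [hcast, hn, Int.cast_natCast, ZMod.val_natCast, Nat.mod_eq_of_lt hnL]

/-- **Every point of a residue-`r₀` point's block is that point plus a centred lift**: if `A.val % Lc = r₀` and `x′.val / Lc = A.val / Lc`
then the centred representative of `red x′ − r₀` is `x′.val − A.val`, and `x′ = A + clift (red x′ − r₀)`. -/
theorem eq_add_clift_of_block_eq {A x' : ZMod Lf} (hA : A.val % Lc = (Lc - 1) / 2) (hblk : x'.val / Lc = A.val / Lc) :
    Torus.cRepZ ((((x'.val : ℕ) : ZMod Lc)) - (((Lc - 1) / 2 : ℕ) : ZMod Lc)) = (x'.val : ℤ) - A.val ∧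
      x' = A + ((Torus.cRepZ ((((x'.val : ℕ) : ZMod Lc)) - (((Lc - 1) / 2 : ℕ) : ZMod Lc)) : ℤ) : ZMod Lf) := by
  have hLc : 1 ≤ Lc := Nat.one_le_iff_ne_zero.2 (NeZero.ne Lc)
  have hdA : Lc * (A.val / Lc) + A.val % Lc = A.val := Nat.div_add_mod A.val Lc
  have hdx : Lc * (x'.val / Lc) + x'.val % Lc = x'.val := Nat.div_add_mod x'.val Lc
  have hxm : x'.val % Lc < Lc := Nat.mod_lt _ (by omega)
  have hdiff : (x'.val : ℤ) - A.val = ((x'.val % Lc : ℕ) : ℤ) - (((Lc - 1) / 2 : ℕ) : ℤ) := by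
    have h1 : ((Lc * (x'.val / Lc) : ℕ) : ℤ) + ((x'.val % Lc : ℕ) : ℤ) = x'.val := by exact_mod_cast hdx
    have h2 : ((Lc * (A.val / Lc) : ℕ) : ℤ) + ((A.val % Lc : ℕ) : ℤ) = A.val := by exact_mod_cast hdA
    have h3 : ((Lc * (x'.val / Lc) : ℕ) : ℤ) = ((Lc * (A.val / Lc) : ℕ) : ℤ) := by rw [hblk]
    have h4 : ((A.val % Lc : ℕ) : ℤ) = (((Lc - 1) / 2 : ℕ) : ℤ) := by rw [hA]
    linarith
  have hrep : Torus.cRepZ ((((x'.val : ℕ) : ZMod Lc)) - (((Lc - 1) / 2 : ℕ) : ZMod Lc)) = (x'.val : ℤ) - A.val := by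
    rw [cRepZ_eq_valMinAbs, ZMod.valMinAbs_spec]
    refine ⟨?_, ?_⟩
    · rw [hdiff, Int.cast_sub, Int.cast_natCast, Int.cast_natCast, ZMod.natCast_mod]
    · rw [hdiff]
      have hxz : ((x'.val % Lc : ℕ) : ℤ) < Lc := by exact_mod_cast hxm
      have hx0 : (0 : ℤ) ≤ ((x'.val % Lc : ℕ) : ℤ) := by positivity
      constructor <;> omega
  refine ⟨hrep, ?_⟩
  rw [hrep]
  push_cast
  rw [ZMod.natCast_zmod_val, ZMod.natCast_zmod_val]
  ring

end OneCoordinate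

/-! ## §2 Sites and legs: the centred block around a residue-`r₀` pin is its `⌊x/m⌋`-block -/

section Sites

variable {b Lc Lf N : ℕ} [NeZero Lc] [NeZero Lf]

omit [NeZero Lc] [NeZero Lf] in
/-- The reduction of a residue-`r₀` site is `c̄ = (r₀, r₀)`. -/
theorem red_eq_cbar_of_residue {wsite : TorusSite 2 Lf} (hw : ∀ i, (wsite i).val % Lc = (Lc - 1) / 2) :
    (fun i => (((wsite i).val : ℕ) : ZMod Lc)) = fun _ : Fin 2 => (((Lc - 1) / 2 : ℕ) : ZMod Lc) := by
  funext i
  rw [← ZMod.natCast_mod, hw i]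

/-- **The embedded coarse site stays in the pin's block and reduces to the coarse site**: for `x̄ : TorusSite 2 Lc`, the fine site
`wsite + clift (x̄ − c̄)` has, in every coordinate, the block of `wsite` and the residue of `x̄`. -/
theorem block_and_red_of_blockEmb (hL : Lf = b * Lc) {wsite : TorusSite 2 Lf} (hw : ∀ i, (wsite i).val % Lc = (Lc - 1) / 2)
    (xbar : TorusSite 2 Lc) (i : Fin 2) :
    ((wsite + Torus.proj Lf (Torus.cRep (xbar - fun _ : Fin 2 => (((Lc - 1) / 2 : ℕ) : ZMod Lc)))) i).val / Lc = (wsite i).val / Lc ∧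
      (((((wsite + Torus.proj Lf (Torus.cRep (xbar - fun _ : Fin 2 => (((Lc - 1) / 2 : ℕ) : ZMod Lc)))) i).val : ℕ) : ZMod Lc)) = xbar i := by
  have hLc : 0 < Lc := Nat.pos_of_ne_zero (NeZero.ne Lc)
  set r₀ : ℕ := (Lc - 1) / 2 with hr₀
  set c : ℤ := Torus.cRepZ ((xbar - fun _ : Fin 2 => ((r₀ : ℕ) : ZMod Lc)) i) with hc
  have hcb := cRepZ_bounds_r₀ ((xbar - fun _ : Fin 2 => ((r₀ : ℕ) : ZMod Lc)) i)
  rw [← hc] at hcb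
  have hsite : (wsite + Torus.proj Lf (Torus.cRep (xbar - fun _ : Fin 2 => ((r₀ : ℕ) : ZMod Lc)))) i = wsite i + (c : ZMod Lf) := by
    rw [Pi.add_apply, Torus.proj_apply, Torus.cRep]
  have hval : (((wsite i + (c : ZMod Lf)).val : ℕ) : ℤ) = ((wsite i).val : ℤ) + c := val_add_intCast_of_residue hL (hw i) hcb.1 hcb.2
  -- the integer `r₀ + c` is a natural number `< Lc`
  obtain ⟨s, hs⟩ := Int.eq_ofNat_of_zero_le (show (0 : ℤ) ≤ (r₀ : ℤ) + c by have := hcb.1; omega)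
  have hsLc : s < Lc := by
    have : (s : ℤ) < Lc := by rw [← hs]; have := hcb.2; omega
    exact_mod_cast this
  set Q : ℕ := Lc * ((wsite i).val / Lc) with hQ
  have hdm : Q + (wsite i).val % Lc = (wsite i).val := Nat.div_add_mod _ _
  rw [hw i] at hdm
  have hn : (wsite i + (c : ZMod Lf)).val = Q + s := by
    have h1 : (((wsite i + (c : ZMod Lf)).val : ℕ) : ℤ) = ((Q + s : ℕ) : ℤ) := by
      rw [hval, ← hdm]
      push_cast
      linarith [hs]
    exact_mod_cast h1
  rw [hsite]
  constructor
  · rw [hn, hQ, Nat.mul_add_div hLc, Nat.div_eq_of_lt hsLc, add_zero]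
  · rw [hn, hQ]
    push_cast
    rw [ZMod.natCast_self, zero_mul, zero_add]
    -- `(s : ZMod Lc) = xbar i`: `s = r₀ + c` and `c ≡ xbar i − r₀`
    have h1 : ((s : ℕ) : ZMod Lc) = ((r₀ : ℕ) : ZMod Lc) + ((c : ℤ) : ZMod Lc) := by
      have := congrArg (fun z : ℤ => (z : ZMod Lc)) hs
      simp only [Int.cast_add, Int.cast_natCast] at this
      exact this.symm
    rw [h1, hc, Torus.intCast_cRepZ, Pi.sub_apply]
    ring

/-- **Every site of the pin's block is an embedded coarse site.** -/
theorem eq_blockEmb_of_block_eq {wsite x' : TorusSite 2 Lf} (hw : ∀ i, (wsite i).val % Lc = (Lc - 1) / 2)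
    (hblk : ∀ i, (x' i).val / Lc = (wsite i).val / Lc) :
    x' = wsite + Torus.proj Lf (Torus.cRep ((fun i => (((x' i).val : ℕ) : ZMod Lc)) - fun _ : Fin 2 => (((Lc - 1) / 2 : ℕ) : ZMod Lc))) := by
  funext i
  rw [Pi.add_apply, Torus.proj_apply, Torus.cRep, Pi.sub_apply]
  exact (eq_add_clift_of_block_eq (hw i) (hblk i)).2

end Sites

/-! ## §3 The read-out's defect at a residue-`r₀` pin is the `(σ,+;σ,−)` string of the pinned copies defect -/

section Glue

variable {b Lc Lf N : ℕ} [NeZero Lc] [NeZero Lf]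

/-- **GLUE.**  For the block structure `e` of `exists_gridLegBlockEquiv` (`blk = ⌊x/m⌋`, `red = x mod m`), embeddings `F β` of the copies
(`(F β v) X′ = [blk X′ = β]·v (red X′)`), a fine pin `w` of residue `(r₀, r₀)`, `r₀ = (Lc−1)/2`, any coarse / fine grid elements `W`, `W′`
and any spin `σ`:
`Σ_{p₁} ‖W₂(ō⁺,p₁⁻) − W′₂(w⁺,(ι p₁)⁻)‖ + Σ_{p₁′ ∉ range ι} ‖W′₂(w⁺,p₁′⁻)‖ = Σ_{p₁′} ‖W′₂(w⁺,p₁′⁻) − (Σ_β W∘F β)₂(w⁺,p₁′⁻)‖`. -/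
theorem gridDefect_pin_eq_copies_defect (hL : Lf = b * Lc)
    (e : GridLeg (GridPoint Lf N) ≃ (Fin 2 → Fin b) × GridLeg (GridPoint Lc N))
    (he1 : ∀ X' i, ((e X').1 i : ℕ) = (X'.1.1.2 i).val / Lc)
    (he2 : ∀ X', (e X').2 = (((X'.1.1.1, fun i => (((X'.1.1.2 i).val : ℕ) : ZMod Lc)), X'.1.2), X'.2))
    (F : (Fin 2 → Fin b) → (GridLeg (GridPoint Lc N) → ℂ) →ₗ[ℂ] (GridLeg (GridPoint Lf N) → ℂ))
    (hF : ∀ β v X', F β v X' = if (e X').1 = β then v (e X').2 else 0)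
    {w : GridPoint Lf N} (hw : ∀ i, (w.2 i).val % Lc = (Lc - 1) / 2)
    (W : GrassmannAlgebra ℂ (GridLeg (GridPoint Lc N))) (W' : GrassmannAlgebra ℂ (GridLeg (GridPoint Lf N))) (σ : Fin 2) :
    (∑ p₁ : GridPoint Lc N, ‖kernel ℂ W 2 (fun i => ((![((w.1, fun _ : Fin 2 => (((Lc - 1) / 2 : ℕ) : ZMod Lc)) : GridPoint Lc N), p₁] i, σ), i)) -
        kernel ℂ W' 2 (fun i => ((![w, ((p₁.1, w.2 + Torus.proj Lf (Torus.cRep (p₁.2 - fun _ : Fin 2 => (((Lc - 1) / 2 : ℕ) : ZMod Lc)))) :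
          GridPoint Lf N)] i, σ), i))‖) +
      ∑ p₁' ∈ univ.filter (fun p₁' : GridPoint Lf N => p₁' ∉ Set.range (fun p : GridPoint Lc N =>
          ((p.1, w.2 + Torus.proj Lf (Torus.cRep (p.2 - fun _ : Fin 2 => (((Lc - 1) / 2 : ℕ) : ZMod Lc)))) : GridPoint Lf N))),
        ‖kernel ℂ W' 2 (fun i => ((![w, p₁'] i, σ), i))‖ =
    ∑ p₁' : GridPoint Lf N, ‖kernel ℂ W' 2 (fun i => ((![w, p₁'] i, σ), i)) -
      kernel ℂ (∑ β, ExteriorAlgebra.map (F β) W) 2 (fun i => ((![w, p₁'] i, σ), i))‖ := by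
  classical
  set cbar : TorusSite 2 Lc := fun _ : Fin 2 => (((Lc - 1) / 2 : ℕ) : ZMod Lc) with hcbar
  set ι : GridPoint Lc N → GridPoint Lf N := fun p => (p.1, w.2 + Torus.proj Lf (Torus.cRep (p.2 - cbar))) with hι
  have hιinj : Function.Injective ι := blockEmb_injective (N := N) hL w.2 cbar
  -- block of a leg = block of its site, coordinatewise
  have hblk : ∀ X' Y' : GridLeg (GridPoint Lf N), (e X').1 = (e Y').1 ↔ ∀ i, (X'.1.1.2 i).val / Lc = (Y'.1.1.2 i).val / Lc := by
    intro X' Y'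
    constructor
    · intro h i
      rw [← he1, ← he1, h]
    · intro h
      funext i
      exact Fin.ext (by rw [he1, he1, h i])
  -- the copies kernel on the `(w⁺, p₁′⁻)` string
  have hcop : ∀ p₁' : GridPoint Lf N, kernel ℂ (∑ β, ExteriorAlgebra.map (F β) W) 2 (fun i => ((![w, p₁'] i, σ), i)) =
      if ∀ i, (p₁'.2 i).val / Lc = (w.2 i).val / Lc then
        kernel ℂ W 2 (fun i => ((![((w.1, cbar) : GridPoint Lc N), (p₁'.1, fun l => (((p₁'.2 l).val : ℕ) : ZMod Lc))] i, σ), i))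
      else 0 := by
    intro p₁'
    rw [kernel_copies_sum e F hF W (0 : Fin 2)]
    have hiff : (∀ i : Fin 2, (e ((![w, p₁'] i, σ), i)).1 = (e ((![w, p₁'] (0 : Fin 2), σ), (0 : Fin 2))).1) ↔
        ∀ i, (p₁'.2 i).val / Lc = (w.2 i).val / Lc := by
      constructor
      · intro h
        have h1 := (hblk _ _).1 (h 1)
        simpa using h1
      · intro h i
        fin_cases i
        · rfl
        · exact (hblk _ _).2 (by simpa using h)
    simp only [hiff]
    split_ifs with h
    · congr 1
      funext i
      rw [he2]
      fin_cases i
      · simp only [Fin.zero_eta, Fin.isValue, Matrix.cons_val_zero]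
        rw [red_eq_cbar_of_residue hw]
      · simp
    · rfl
  -- split the right-hand side over the range of ι and its complement
  rw [← Finset.sum_filter_add_sum_filter_not (Finset.univ) (fun p₁' : GridPoint Lf N => p₁' ∈ Set.range ι)]
  congr 1
  · -- on the range: reindex by ι and read the copies kernel
    have hrange : (Finset.univ.filter (fun p₁' : GridPoint Lf N => p₁' ∈ Set.range ι)) = Finset.univ.image ι := by
      ext p₁'; simp [Set.mem_range, eq_comm]
    rw [hrange, Finset.sum_image (fun p _ q _ h => hιinj h)]
    refine Finset.sum_congr rfl fun p₁ _ => ?_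
    have hb := fun i => (block_and_red_of_blockEmb hL hw p₁.2 i)
    have hp : (((ι p₁).1, fun l => ((((ι p₁).2 l).val : ℕ) : ZMod Lc)) : GridPoint Lc N) = p₁ :=
      Prod.ext rfl (funext fun l => (hb l).2)
    rw [hcop (ι p₁), if_pos (fun i => (hb i).1), hp, norm_sub_rev]
  · refine Finset.sum_congr rfl fun p₁' hp => ?_
    have hp' : p₁' ∉ Set.range ι := (Finset.mem_filter.1 hp).2
    rw [hcop, if_neg, sub_zero]
    intro hall
    exact hp' ⟨(p₁'.1, fun l => (((p₁'.2 l).val : ℕ) : ZMod Lc)), by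
      simp only [hι]
      exact Prod.ext rfl (eq_blockEmb_of_block_eq hw hall).symm⟩

end Glue

end Summit.HubbardSuperconductivity.HubbardSuperconductivity.Theorems.TwoVolumeDefect

end
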